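import Literature.Analysis.Complex.ArgumentPrincipleRectangle
import HarnessLib

/-!
# The argument principle on a rectangle with zeros on one edge

Trunk T-ANALYSIS support (`Literature/Analysis/Complex`). The tree's argument principle on a
rectangle (`Literature.Analysis.Complex.integral_boundary_rect_logDeriv`, `ArgumentPrincipleRectangle.lean`:
`∮_{∂R} f'/f = 2πi Σ_{ρ ∈ R°} m(ρ)` for `f` analytic on the closed rectangle `R = [a,b] × [c,d]` and
non-zero on `∂R`) is extended here to the case in which `f` may vanish on the **left edge**
`{a} × (c, d)` — the situation of Levinson's method, where the left edge is the critical line and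
the zeros of the auxiliary function on it must be credited, not excluded (Conrey, *J. Number
Theory* 16 (1983), §4, (2)–(3): "`(1/π) Δ arg V(½ + it)|_T^{T+U} = −2N + O(L)`", with `arg`
continued along the line by `+nπ` across a zero of multiplicity `n`).

In the branch-free language of logarithmic derivatives the statement reads
(`integral_re_logDeriv_left_add_finsum_eq`): for `f` analytic at every point of `R` (`a < b`,
`c < d`) and non-zero on the bottom, top and right edges,

  `∫_c^d Re (f'/f)(a+it) dt + π Σ_{ρ ∈ {a}×(c,d), f(ρ)=0} m(ρ)`
  `   = Im ∫_a^b (f'/f)(x+ic) dx − Im ∫_a^b (f'/f)(x+id) dx + ∫_c^d Re (f'/f)(b+it) dt − 2π Σ_{ρ ∈ R°, f(ρ)=0} m(ρ)`.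

Here `∫_c^d Re (f'/f)(a+it) dt` is an honest Lebesgue integral: near a zero `ρ = a + it₀` of
multiplicity `n` on the edge, `f'/f = n/(s − ρ) + (analytic)` and `Re n/(s − ρ)` vanishes
identically on the vertical line through `ρ`, so `t ↦ Re (f'/f)(a+it)` is bounded and continuous
off the finitely many ordinates of zeros (`intervalIntegrable_re_logDeriv_left`; at those
ordinates Lean's `f'/0 = 0` supplies irrelevant values). The left side is the change of `arg f`
along the edge, continued upwards with the jump `+nπ` at each zero (the one-sided limits of
`arg f(a+it)` at `t₀` differ by `nπ (mod 2π)`), and the identity says that this generalised change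
equals the boundary terms on the other three edges minus `2π ×` (the zeros *inside*): the zeros on
the edge cost nothing beyond their jumps.

Proof: induction on the finite set of ordinates of zeros on the edge, dividing out `(s − ρ)^n` at
one of them (as in `ArgumentPrincipleRectangle.lean`); the quotient has the same interior zeros
and orders, `Re (f'/f) = Re (f₁'/f₁)` a.e. on the left edge, and on the other three edges the extra
term `n/(s − ρ)` contributes exactly
`n · (Im[log(s−ρ)]_{a+ic}^{b+ic} − Im[log(s−ρ)]_{a+id}^{b+id} + Im[log(s−ρ)]_{b+ic}^{b+id}) = n (arg(i(d−t₀)) − arg(i(c−t₀))) = nπ`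
(principal logarithms; `s − ρ` stays in a fixed open half-plane along each of these edges,
`Literature.Analysis.Complex.integral_logDeriv_horizontal` / `_vertical`). The base case is the tree's
argument principle.

## Main results

* `finite_zeros_closed_reProdIm` — finiteness of the zeros in the *closed* rectangle;
  `finite_leftEdge_zeros` — of the ordinates of the zeros on the left edge.
* `threeEdge_inv_sub_eq_pi` — the three-edge integral of `1/(s − ρ)` for `ρ` on the open left edge is `π`.
* `intervalIntegrable_re_logDeriv_left` — `t ↦ Re (f'/f)(a+it)` is integrable on `[c, d]`.
* `integral_re_logDeriv_left_add_sum_eq` (with a finite set `S ⊇` ordinates of the edge zeros),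
  `integral_re_logDeriv_left_add_finsum_eq` — the identity displayed above.

## References

* J. B. Conway, *Functions of One Complex Variable I*, 2nd ed., GTM 11, Springer 1978, Ch. V §3
  (argument principle). [Conway1978]
* J. B. Conrey, *Zeros of derivatives of Riemann's ξ-function on the critical line*, J. Number
  Theory 16 (1983), 49–74, §4 (2)–(3).
* E. C. Titchmarsh, *The Theory of the Riemann Zeta-Function*, 2nd ed. (1986), §9.3–9.4, §10.28.
-/

noncomputable section

open Complex Set MeasureTheory Filter Topology intervalIntegral

namespace Literature.Analysis.Complex

variable {a b c d : ℝ}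

/-! ## Finiteness of the zeros on the closed rectangle and on the left edge -/

/-- An analytic function on the closed rectangle `[a,b] × [c,d]`, non-zero somewhere on it, has
finitely many zeros in the closed rectangle. [folklore] -/
theorem finite_zeros_closed_reProdIm {f : ℂ → ℂ} (hab : a ≤ b) (hcd : c ≤ d)
    (hf : AnalyticOnNhd ℂ f (Icc a b ×ℂ Icc c d)) {w : ℂ} (hw : w ∈ Icc a b ×ℂ Icc c d)
    (hfw : f w ≠ 0) : {ρ : ℂ | f ρ = 0 ∧ ρ ∈ Icc a b ×ℂ Icc c d}.Finite := by
  have hK : IsCompact (Icc a b ×ℂ Icc c d) := isCompact_Icc.reProdIm isCompact_Icc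
  refine ((MeromorphicOn.divisor f (Icc a b ×ℂ Icc c d)).finiteSupport hK).subset ?_
  rintro ρ ⟨hρ0, hρK⟩
  rw [Function.mem_support, hf.meromorphicOn.divisor_apply hρK]
  have hne := analyticOrderAt_ne_top_of_reProdIm hab hcd hf hw hfw hρK
  rw [(hf ρ hρK).meromorphicOrderAt_eq]
  cases h : analyticOrderAt f ρ with
  | top => exact absurd h hne
  | coe n =>
    have hn : n ≠ 0 := by
      intro hn0
      rw [hn0] at h
      exact ((hf ρ hρK).analyticOrderAt_eq_zero.1 (by exact_mod_cast h)) hρ0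
    simpa using hn

/-- The ordinates of the zeros of `f` on the left edge `{a} × [c, d]` form a finite set (for `f`
analytic on the closed rectangle and non-zero somewhere on it). [folklore] -/
theorem finite_leftEdge_zeros {f : ℂ → ℂ} (hab : a ≤ b) (hcd : c ≤ d)
    (hf : AnalyticOnNhd ℂ f (Icc a b ×ℂ Icc c d)) {w : ℂ} (hw : w ∈ Icc a b ×ℂ Icc c d)
    (hfw : f w ≠ 0) : {y : ℝ | f (a + y * I) = 0 ∧ y ∈ Icc c d}.Finite := by
  have hfin := finite_zeros_closed_reProdIm hab hcd hf hw hfw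
  have hinj : Set.InjOn (fun y : ℝ ↦ (a : ℂ) + y * I) univ := by
    intro y _ y' _ h
    have := congrArg Complex.im h
    simpa using this
  refine (hfin.preimage (hinj.mono (subset_univ _))).subset ?_
  intro y hy
  refine ⟨hy.1, ?_⟩
  exact ⟨by simpa using hab, by simpa using hy.2⟩

/-! ## The three-edge integral of `1/(s − ρ)` for `ρ` on the left edge -/

/-- For `ρ = a + it₀` with `c < t₀ < d` and `a < b`: the integral of `1/(s − ρ)` along the bottom,
right and top edges of `[a,b] × [c,d]`, in the combination
`Im ∫_a^b dx/(x+ic−ρ) − Im ∫_a^b dx/(x+id−ρ) + Re ∫_c^d dt/(b+it−ρ)`, equals `π`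
(the argument of `s − ρ` increases from `−π/2` at `a + ic` to `+π/2` at `a + id` along this path).
[folklore] -/
theorem threeEdge_inv_sub_eq_pi (hab : a < b) {t₀ : ℝ} (hc : c < t₀) (hd : t₀ < d) :
    (∫ x in a..b, ((x : ℂ) + c * I - (a + t₀ * I))⁻¹).im -
        (∫ x in a..b, ((x : ℂ) + d * I - (a + t₀ * I))⁻¹).im +
        (∫ y in c..d, ((b : ℂ) + y * I - (a + t₀ * I))⁻¹).re = Real.pi := by
  set ρ : ℂ := a + t₀ * I with hρ
  set g : ℂ → ℂ := fun z ↦ z - ρ with hg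
  have hg_an : ∀ z : ℂ, AnalyticAt ℂ g z := fun z ↦ analyticAt_id.sub analyticAt_const
  have hg_deriv : ∀ z : ℂ, deriv g z = 1 := fun z ↦ by
    rw [hg]; simp
  have hquot : ∀ z : ℂ, deriv g z / g z = (z - ρ)⁻¹ := fun z ↦ by
    rw [hg_deriv, one_div]
  -- the three edges stay in open half-planes avoiding `(-∞, 0]`
  have hs_bot : ∀ x ∈ Icc a b, g (x + c * I) ∈ slitPlane := fun x _ ↦ by
    rw [mem_slitPlane_iff]; right; simp [hg, hρ]; linarith
  have hs_top : ∀ x ∈ Icc a b, g (x + d * I) ∈ slitPlane := fun x _ ↦ by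
    rw [mem_slitPlane_iff]; right; simp [hg, hρ]; linarith
  have hs_right : ∀ y ∈ Icc c d, g (b + y * I) ∈ slitPlane := fun y _ ↦ by
    rw [mem_slitPlane_iff]; left; simp [hg, hρ]; linarith
  have e_bot := integral_logDeriv_horizontal (g := g) c hab.le (fun x _ ↦ hg_an _) hs_bot
  have e_top := integral_logDeriv_horizontal (g := g) d hab.le (fun x _ ↦ hg_an _) hs_top
  have e_right := integral_logDeriv_vertical (g := g) b (hc.le.trans hd.le) (fun y _ ↦ hg_an _)
    hs_right
  simp only [hquot] at e_bot e_top e_right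
  -- the right-edge real part is the imaginary part of `i ∫`
  have hre : (∫ y in c..d, ((b : ℂ) + y * I - (a + t₀ * I))⁻¹).re =
      (I * ∫ y in c..d, ((b : ℂ) + y * I - (a + t₀ * I))⁻¹).im := by rw [I_mul_im]
  rw [hre, e_bot, e_top, e_right]
  -- the corner values of `g`
  have g_ac : g (a + c * I) = ((t₀ - c : ℝ) : ℂ) * (-I) := by
    simp only [hg, hρ]; push_cast; ring
  have g_ad : g (a + d * I) = ((d - t₀ : ℝ) : ℂ) * I := by
    simp only [hg, hρ]; push_cast; ring
  simp only [sub_im, log_im]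
  rw [g_ac, g_ad, arg_real_mul _ (by linarith : (0 : ℝ) < t₀ - c),
    arg_real_mul _ (by linarith : (0 : ℝ) < d - t₀), arg_neg_I, arg_I]
  ring

/-! ## The identity, by induction on the zeros of the left edge -/

/-- Elementary identity used to log-differentiate `(z-ρ)^m · f₁`. [folklore] -/
private lemma natCast_mul_pow_pred'' (w : ℂ) (hw : w ≠ 0) (m : ℕ) :
    (m : ℂ) * w ^ (m - 1) = w ^ m * (m * w⁻¹) := by
  cases m with
  | zero => simp
  | succ k =>
    rw [Nat.add_sub_cancel, pow_succ]
    field_simp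

/-- The real part of `n/(s − ρ)` vanishes on the vertical line through `ρ`. [folklore] -/
theorem re_inv_sub_vertical_eq_zero (a t₀ y : ℝ) (n : ℂ) (hn : n.im = 0) :
    (n * (((a : ℂ) + y * I) - (a + t₀ * I))⁻¹).re = 0 := by
  have e : ((a : ℂ) + y * I) - (a + t₀ * I) = ((y - t₀ : ℝ) : ℂ) * I := by push_cast; ring
  rw [e, mul_re]
  simp [hn]

/-- **The argument principle with zeros on the left edge** (finite-set form). Let `f` be analytic at
every point of the closed rectangle `K = [a,b] × [c,d]` (`a < b`, `c < d`), non-zero on the bottom,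
top and right edges, and let `S ⊆ (c, d)` be a finite set of reals containing the ordinate of every
zero of `f` on the left edge. Then `t ↦ Re (f'/f)(a+it)` is integrable on `[c, d]` and
`∫_c^d Re(f'/f)(a+it) dt + π Σ_{t ∈ S} m(a+it) = Im ∫_a^b (f'/f)(x+ic) dx − Im ∫_a^b (f'/f)(x+id) dx`
`  + ∫_c^d Re(f'/f)(b+it) dt − 2π Σ_{ρ ∈ K°, f(ρ)=0} m(ρ)`
(`m = meromorphicOrderAt f`, which is `0` at the points `a + it`, `t ∈ S`, where `f ≠ 0`).
[cite: Conway1978, Ch. V Thm. 3.4] -/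
theorem integral_re_logDeriv_left_add_sum_eq (hab : a < b) (hcd : c < d) (S : Finset ℝ) :
    ∀ f : ℂ → ℂ, AnalyticOnNhd ℂ f (Icc a b ×ℂ Icc c d) →
      (∀ x ∈ Icc a b, f (x + c * I) ≠ 0) → (∀ x ∈ Icc a b, f (x + d * I) ≠ 0) →
      (∀ y ∈ Icc c d, f (b + y * I) ≠ 0) →
      (∀ y ∈ Icc c d, f (a + y * I) = 0 → y ∈ S) → ((S : Set ℝ) ⊆ Ioo c d) →
      IntervalIntegrable (fun y : ℝ ↦ (deriv f (a + y * I) / f (a + y * I)).re) volume c d ∧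
      (∫ y in c..d, (deriv f (a + y * I) / f (a + y * I)).re) +
          Real.pi * ∑ t ∈ S, ((meromorphicOrderAt f (a + t * I)).untop₀ : ℝ) =
        (∫ x in a..b, deriv f (x + c * I) / f (x + c * I)).im -
          (∫ x in a..b, deriv f (x + d * I) / f (x + d * I)).im +
          (∫ y in c..d, (deriv f (b + y * I) / f (b + y * I)).re) -
          2 * Real.pi * ∑ᶠ ρ ∈ {ρ : ℂ | f ρ = 0 ∧ ρ ∈ Ioo a b ×ℂ Ioo c d},
            ((meromorphicOrderAt f ρ).untop₀ : ℝ) := by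
  classical
  induction S using Finset.induction_on with
  | empty =>
    intro f hf h_bot h_top h_right hzero _
    have h_left : ∀ y ∈ Icc c d, f (a + y * I) ≠ 0 := fun y hy h0 ↦ by simpa using hzero y hy h0
    -- integrability: the integrand is continuous
    have hcont : ContinuousOn (fun y : ℝ ↦ deriv f (a + y * I) / f (a + y * I)) (Icc c d) := by
      intro y hy
      have hK : ((a : ℂ) + y * I) ∈ Icc a b ×ℂ Icc c d := ⟨by simpa using hab.le, by simpa using hy⟩
      have hc' : Continuous fun y : ℝ ↦ (a : ℂ) + y * I := by fun_prop
      exact (((hf _ hK).deriv.continuousAt.comp (f := fun y : ℝ ↦ (a : ℂ) + y * I)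
        hc'.continuousAt).div ((hf _ hK).continuousAt.comp (f := fun y : ℝ ↦ (a : ℂ) + y * I)
        hc'.continuousAt) (h_left y hy)).continuousWithinAt
    have hcontR : ContinuousOn (fun y : ℝ ↦ deriv f (b + y * I) / f (b + y * I)) (Icc c d) := by
      intro y hy
      have hK : ((b : ℂ) + y * I) ∈ Icc a b ×ℂ Icc c d := ⟨by simpa using hab.le, by simpa using hy⟩
      have hc' : Continuous fun y : ℝ ↦ (b : ℂ) + y * I := by fun_prop
      exact (((hf _ hK).deriv.continuousAt.comp (f := fun y : ℝ ↦ (b : ℂ) + y * I)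
        hc'.continuousAt).div ((hf _ hK).continuousAt.comp (f := fun y : ℝ ↦ (b : ℂ) + y * I)
        hc'.continuousAt) (h_right y hy)).continuousWithinAt
    refine ⟨(continuous_re.comp_continuousOn hcont).intervalIntegrable_of_Icc (μ := volume) hcd.le, ?_⟩
    -- the argument principle, imaginary parts
    have hAP := integral_boundary_rect_logDeriv hab hcd hf h_bot h_top h_left h_right
    have hfin := finite_zeros_reProdIm hab.le hcd.le hf
      (w := (a : ℂ) + c * I) ⟨by simpa using hab.le, by simpa using hcd.le⟩ (h_bot a ⟨le_rfl, hab.le⟩)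
    have him := congrArg Complex.im hAP
    simp only [sub_im, add_im, I_mul_im] at him
    -- real parts of the vertical integrals
    have hL := Complex.reCLM.intervalIntegral_comp_comm
      (hcont.intervalIntegrable_of_Icc (μ := volume) hcd.le)
    have hR := Complex.reCLM.intervalIntegral_comp_comm
      (hcontR.intervalIntegrable_of_Icc (μ := volume) hcd.le)
    simp only [Complex.reCLM_apply] at hL hR
    -- the right-hand side is real
    have e_rhs : (2 * (Real.pi : ℂ) * I * ∑ᶠ ρ ∈ {ρ : ℂ | f ρ = 0 ∧ ρ ∈ Ioo a b ×ℂ Ioo c d},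
        ((meromorphicOrderAt f ρ).untop₀ : ℂ)).im =
        2 * Real.pi * ∑ᶠ ρ ∈ {ρ : ℂ | f ρ = 0 ∧ ρ ∈ Ioo a b ×ℂ Ioo c d},
          ((meromorphicOrderAt f ρ).untop₀ : ℝ) := by
      rw [finsum_mem_eq_finite_toFinset_sum _ hfin, finsum_mem_eq_finite_toFinset_sum _ hfin,
        show (2 * (Real.pi : ℂ) * I) = I * (2 * Real.pi : ℝ) by push_cast; ring, mul_assoc, I_mul_im,
        re_ofReal_mul, re_sum]
      congr 1
    rw [e_rhs, ← hL, ← hR] at him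
    rw [Finset.sum_empty, mul_zero, add_zero]
    linarith
  | insert t₀ S' ht₀S' ih =>
    intro f hf h_bot h_top h_right hzero hsub
    set ρ : ℂ := a + t₀ * I with hρ_def
    have ht₀ : t₀ ∈ Ioo c d := hsub (Finset.mem_coe.2 (Finset.mem_insert_self t₀ S'))
    have hsub' : ((S' : Set ℝ)) ⊆ Ioo c d :=
      (Finset.coe_subset.2 (Finset.subset_insert t₀ S')).trans hsub
    have hρK : ρ ∈ Icc a b ×ℂ Icc c d :=
      ⟨by simpa [hρ_def] using hab.le, by simpa [hρ_def] using Ioo_subset_Icc_self ht₀⟩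
    by_cases hfρ : f ρ ≠ 0
    · -- no zero at `ρ`: the order there is `0` and the induction hypothesis applies directly
      have hzero' : ∀ y ∈ Icc c d, f (a + y * I) = 0 → y ∈ S' := by
        intro y hy h0
        have h := hzero y hy h0
        rw [Finset.mem_insert] at h
        rcases h with h | h
        · exact absurd h0 (by rw [h]; exact hfρ)
        · exact h
      obtain ⟨hint, hid⟩ := ih f hf h_bot h_top h_right hzero' hsub'
      refine ⟨hint, ?_⟩
      have horder : ((meromorphicOrderAt f (a + t₀ * I)).untop₀ : ℝ) = 0 := by
        rw [(hf ρ hρK).meromorphicOrderAt_eq, ((hf ρ hρK).analyticOrderAt_eq_zero).2 hfρ]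
        simp
      rw [Finset.sum_insert ht₀S', horder, zero_add]
      exact hid
    push Not at hfρ
    -- a zero at `ρ`: divide out `(z - ρ)^m`
    have hcorner : ((a : ℂ) + c * I) ∈ Icc a b ×ℂ Icc c d :=
      ⟨by simpa using hab.le, by simpa using hcd.le⟩
    have hw : f (a + c * I) ≠ 0 := h_bot a ⟨le_rfl, hab.le⟩
    have hne_top : analyticOrderAt f ρ ≠ ⊤ :=
      analyticOrderAt_ne_top_of_reProdIm hab.le hcd.le hf hcorner hw hρK
    obtain ⟨g, hg_an, hg_ne, hfg⟩ := (hf ρ hρK).analyticOrderAt_ne_top.mp hne_top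
    set m : ℕ := analyticOrderNatAt f ρ with hm
    set f₁ : ℂ → ℂ := fun z ↦ if z = ρ then g ρ else f z / (z - ρ) ^ m with hf₁_def
    have hf₁_of_ne : ∀ z, z ≠ ρ → f₁ z = f z / (z - ρ) ^ m := fun z hz ↦ by
      simp [hf₁_def, hz]
    have hf_eq : ∀ z, z ≠ ρ → f z = (z - ρ) ^ m * f₁ z := fun z hz ↦ by
      rw [hf₁_of_ne z hz, mul_div_cancel₀ _ (pow_ne_zero _ (sub_ne_zero.2 hz))]
    have hf₁ρ : f₁ =ᶠ[𝓝 ρ] g := by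
      filter_upwards [hfg] with z hz
      by_cases hzρ : z = ρ
      · subst hzρ; simp [hf₁_def]
      · rw [hf₁_of_ne z hzρ, hz, smul_eq_mul, mul_div_cancel_left₀ _
          (pow_ne_zero _ (sub_ne_zero.2 hzρ))]
    have hf_ev : ∀ z, z ≠ ρ → f =ᶠ[𝓝 z] fun w ↦ (w - ρ) ^ m * f₁ w := fun z hz ↦
      (isOpen_ne.eventually_mem hz).mono fun w hw ↦ hf_eq w hw
    have hf₁_an : AnalyticOnNhd ℂ f₁ (Icc a b ×ℂ Icc c d) := by
      intro z hz
      by_cases hzρ : z = ρ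
      · subst hzρ
        exact hg_an.congr hf₁ρ.symm
      · have h1 : AnalyticAt ℂ (fun w ↦ f w / (w - ρ) ^ m) z :=
          (hf z hz).div ((analyticAt_id.sub analyticAt_const).pow m)
            (pow_ne_zero _ (sub_ne_zero.2 hzρ))
        refine h1.congr ?_
        exact (isOpen_ne.eventually_mem hzρ).mono fun w hw ↦ (hf₁_of_ne w hw).symm
    have hf₁ρ_ne : f₁ ρ ≠ 0 := by simpa [hf₁_def] using hg_ne
    -- `f₁` inherits the non-vanishing on the three edges, and its left zeros lie in `S'`
    have hne_edge : ∀ z, f z ≠ 0 → z ≠ ρ := fun z hz h ↦ hz (h ▸ hfρ)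
    have hf₁_ne : ∀ z, f z ≠ 0 → f₁ z ≠ 0 := by
      intro z hz h0
      exact hz (by rw [hf_eq z (hne_edge z hz), h0, mul_zero])
    have h_bot₁ : ∀ x ∈ Icc a b, f₁ (x + c * I) ≠ 0 := fun x hx ↦ hf₁_ne _ (h_bot x hx)
    have h_top₁ : ∀ x ∈ Icc a b, f₁ (x + d * I) ≠ 0 := fun x hx ↦ hf₁_ne _ (h_top x hx)
    have h_right₁ : ∀ y ∈ Icc c d, f₁ (b + y * I) ≠ 0 := fun y hy ↦ hf₁_ne _ (h_right y hy)
    have hzero₁ : ∀ y ∈ Icc c d, f₁ (a + y * I) = 0 → y ∈ S' := by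
      intro y hy h0
      have hyρ : (a : ℂ) + y * I ≠ ρ := fun h ↦ hf₁ρ_ne (h ▸ h0)
      have hfz : f (a + y * I) = 0 := by rw [hf_eq _ hyρ, h0, mul_zero]
      have h := hzero y hy hfz
      rw [Finset.mem_insert] at h
      rcases h with h | h
      · exact absurd (by rw [hρ_def, h]) hyρ
      · exact h
    obtain ⟨hint₁, hid₁⟩ := ih f₁ hf₁_an h_bot₁ h_top₁ h_right₁ hzero₁ hsub'
    -- the logarithmic derivative splits off the edges' zero
    have hsplit : ∀ z ∈ Icc a b ×ℂ Icc c d, z ≠ ρ → f z ≠ 0 →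
        deriv f z / f z = (m : ℂ) * (z - ρ)⁻¹ + deriv f₁ z / f₁ z := by
      intro z hz hzρ hfz
      have hzρ' : z - ρ ≠ 0 := sub_ne_zero.2 hzρ
      have hf₁z : f₁ z ≠ 0 := hf₁_ne z hfz
      have hderiv : deriv f z = (m : ℂ) * (z - ρ) ^ (m - 1) * f₁ z + (z - ρ) ^ m * deriv f₁ z := by
        rw [(hf_ev z hzρ).deriv_eq]
        have h1 : HasDerivAt (fun w : ℂ ↦ (w - ρ) ^ m) ((m : ℂ) * (z - ρ) ^ (m - 1) * 1) z :=
          ((hasDerivAt_id z).sub_const ρ).pow m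
        have h2 : HasDerivAt f₁ (deriv f₁ z) z := (hf₁_an z hz).differentiableAt.hasDerivAt
        have h3 : HasDerivAt (fun w : ℂ ↦ (w - ρ) ^ m * f₁ w)
            ((m : ℂ) * (z - ρ) ^ (m - 1) * 1 * f₁ z + (z - ρ) ^ m * deriv f₁ z) z := h1.mul h2
        rw [h3.deriv]
        ring
      rw [hderiv, natCast_mul_pow_pred'' (z - ρ) hzρ' m, hf_eq z hzρ]
      field_simp
    -- (i) the left edge: `Re (f'/f) = Re (f₁'/f₁)` off the finite set `insert t₀ S'`
    have hleft_mem : ∀ y ∈ Icc c d, ((a : ℂ) + y * I) ∈ Icc a b ×ℂ Icc c d := fun y hy ↦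
      ⟨by simpa using hab.le, by simpa using hy⟩
    have hae : ∀ᵐ y ∂volume, y ∈ Set.uIoc c d →
        (deriv f (a + y * I) / f (a + y * I)).re = (deriv f₁ (a + y * I) / f₁ (a + y * I)).re := by
      have h0 : volume ((insert t₀ S' : Finset ℝ) : Set ℝ) = 0 := Finset.measure_zero _ _
      filter_upwards [measure_eq_zero_iff_ae_notMem.1 h0] with y hy hyI
      rw [uIoc_of_le hcd.le] at hyI
      have hyIcc : y ∈ Icc c d := Ioc_subset_Icc_self hyI
      have hfy : f (a + y * I) ≠ 0 := fun h ↦ hy (hzero y hyIcc h)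
      have hyρ : (a : ℂ) + y * I ≠ ρ := hne_edge _ hfy
      rw [hsplit _ (hleft_mem y hyIcc) hyρ hfy, add_re, hρ_def,
        re_inv_sub_vertical_eq_zero a t₀ y (m : ℂ) (by simp), zero_add]
    have hint : IntervalIntegrable (fun y : ℝ ↦ (deriv f (a + y * I) / f (a + y * I)).re)
        volume c d := by
      refine hint₁.congr_ae ?_
      refine (ae_restrict_iff' measurableSet_uIoc).2 ?_
      filter_upwards [hae] with y hy hyI
      exact (hy hyI).symm
    refine ⟨hint, ?_⟩
    have e_left : ∫ y in c..d, (deriv f (a + y * I) / f (a + y * I)).re =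
        ∫ y in c..d, (deriv f₁ (a + y * I) / f₁ (a + y * I)).re :=
      intervalIntegral.integral_congr_ae hae
    -- (ii) the orders: `m` at `ρ`, equal elsewhere
    have horder_ρ : ((meromorphicOrderAt f (a + t₀ * I)).untop₀ : ℝ) = m := by
      rw [← hρ_def, (hf ρ hρK).meromorphicOrderAt_eq, ← Nat.cast_analyticOrderNatAt hne_top]
      simp [hm]
    have horder_eq : ∀ z ∈ Icc a b ×ℂ Icc c d, z ≠ ρ →
        meromorphicOrderAt f z = meromorphicOrderAt f₁ z := by
      intro z hz hne
      have h1 : meromorphicOrderAt f z = meromorphicOrderAt (fun w ↦ (w - ρ) ^ m * f₁ w) z :=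
        meromorphicOrderAt_congr ((hf_ev z hne).filter_mono nhdsWithin_le_nhds)
      have hpow_an : AnalyticAt ℂ (fun w : ℂ ↦ (w - ρ) ^ m) z :=
        (analyticAt_id.sub analyticAt_const).pow m
      have h2 : meromorphicOrderAt (fun w ↦ (w - ρ) ^ m * f₁ w) z =
          meromorphicOrderAt (fun w : ℂ ↦ (w - ρ) ^ m) z + meromorphicOrderAt f₁ z :=
        fun_meromorphicOrderAt_mul hpow_an.meromorphicAt (hf₁_an z hz).meromorphicAt
      have h3 : meromorphicOrderAt (fun w : ℂ ↦ (w - ρ) ^ m) z = 0 := by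
        rw [hpow_an.meromorphicOrderAt_eq,
          (hpow_an.analyticOrderAt_eq_zero.2 (pow_ne_zero _ (sub_ne_zero.2 hne)))]
        simp
      rw [h1, h2, h3, zero_add]
    have e_sum : ∑ t ∈ insert t₀ S', ((meromorphicOrderAt f (a + t * I)).untop₀ : ℝ) =
        m + ∑ t ∈ S', ((meromorphicOrderAt f₁ (a + t * I)).untop₀ : ℝ) := by
      rw [Finset.sum_insert ht₀S', horder_ρ]
      congr 1
      refine Finset.sum_congr rfl fun t ht ↦ ?_
      have hne : (a : ℂ) + t * I ≠ ρ := by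
        intro h
        have := congrArg Complex.im h
        simp [hρ_def] at this
        exact ht₀S' (this ▸ ht)
      have htK : ((a : ℂ) + t * I) ∈ Icc a b ×ℂ Icc c d :=
        hleft_mem t (Ioo_subset_Icc_self (hsub' (Finset.mem_coe.2 ht)))
      rw [horder_eq _ htK hne]
    have e_int : ∑ᶠ ρ' ∈ {ρ' : ℂ | f ρ' = 0 ∧ ρ' ∈ Ioo a b ×ℂ Ioo c d},
        ((meromorphicOrderAt f ρ').untop₀ : ℝ) =
        ∑ᶠ ρ' ∈ {ρ' : ℂ | f₁ ρ' = 0 ∧ ρ' ∈ Ioo a b ×ℂ Ioo c d},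
          ((meromorphicOrderAt f₁ ρ').untop₀ : ℝ) := by
      have hρ_not : ρ ∉ Ioo a b ×ℂ Ioo c d := by
        intro h
        have := h.1.1
        simp [hρ_def] at this
      have hne_of : ∀ z, z ∈ Ioo a b ×ℂ Ioo c d → z ≠ ρ := fun z hz h ↦ hρ_not (h ▸ hz)
      have hset : {ρ' : ℂ | f ρ' = 0 ∧ ρ' ∈ Ioo a b ×ℂ Ioo c d} =
          {ρ' : ℂ | f₁ ρ' = 0 ∧ ρ' ∈ Ioo a b ×ℂ Ioo c d} := by
        ext z
        simp only [mem_setOf_eq]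
        constructor
        · rintro ⟨h0, hz⟩
          refine ⟨?_, hz⟩
          have h := hf_eq z (hne_of z hz)
          rw [h0] at h
          exact (mul_eq_zero.1 h.symm).resolve_left (pow_ne_zero _ (sub_ne_zero.2 (hne_of z hz)))
        · rintro ⟨h0, hz⟩
          exact ⟨by rw [hf_eq z (hne_of z hz), h0, mul_zero], hz⟩
      refine finsum_mem_congr hset fun z hz ↦ ?_
      rw [horder_eq z ⟨Ioo_subset_Icc_self hz.2.1, Ioo_subset_Icc_self hz.2.2⟩ (hne_of z hz.2)]
    -- (iii) the three edges: `f'/f = m/(z-ρ) + f₁'/f₁`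
    have hbot_mem : ∀ x ∈ Icc a b, ((x : ℂ) + c * I) ∈ Icc a b ×ℂ Icc c d := fun x hx ↦
      ⟨by simpa using hx, by simpa using hcd.le⟩
    have htop_mem : ∀ x ∈ Icc a b, ((x : ℂ) + d * I) ∈ Icc a b ×ℂ Icc c d := fun x hx ↦
      ⟨by simpa using hx, by simpa using hcd.le⟩
    have hright_mem : ∀ y ∈ Icc c d, ((b : ℂ) + y * I) ∈ Icc a b ×ℂ Icc c d := fun y hy ↦
      ⟨by simpa using hab.le, by simpa using hy⟩
    -- continuity of the pieces on the three edges
    have hcont_inv : ∀ z, z ≠ ρ → ContinuousAt (fun w : ℂ ↦ (m : ℂ) * (w - ρ)⁻¹) z := by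
      intro z hz
      exact ((continuousAt_id.sub continuousAt_const).inv₀ (sub_ne_zero.2 hz)).const_mul _
    have hcont_f₁ : ∀ z ∈ Icc a b ×ℂ Icc c d, f z ≠ 0 →
        ContinuousAt (fun w ↦ deriv f₁ w / f₁ w) z := fun z hz hfz ↦
      ((hf₁_an z hz).deriv.continuousAt).div (hf₁_an z hz).continuousAt (hf₁_ne z hfz)
    have hlin_h : ∀ y₀ : ℝ, Continuous fun x : ℝ ↦ (x : ℂ) + y₀ * I := fun y₀ ↦ by fun_prop
    have hlin_v : ∀ x₀ : ℝ, Continuous fun y : ℝ ↦ (x₀ : ℂ) + y * I := fun x₀ ↦ by fun_prop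
    -- horizontal edges
    have e_hor : ∀ y₀ : ℝ, (y₀ = c ∨ y₀ = d) → (∀ x ∈ Icc a b, f (x + y₀ * I) ≠ 0) →
        (∫ x in a..b, deriv f (x + y₀ * I) / f (x + y₀ * I)).im =
          (∫ x in a..b, (m : ℂ) * ((x : ℂ) + y₀ * I - ρ)⁻¹).im +
            (∫ x in a..b, deriv f₁ (x + y₀ * I) / f₁ (x + y₀ * I)).im := by
      intro y₀ hy₀ hne
      have hmem : ∀ x ∈ Icc a b, ((x : ℂ) + y₀ * I) ∈ Icc a b ×ℂ Icc c d := by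
        rcases hy₀ with rfl | rfl
        · exact hbot_mem
        · exact htop_mem
      have h1 : IntervalIntegrable (fun x : ℝ ↦ (m : ℂ) * ((x : ℂ) + y₀ * I - ρ)⁻¹) volume a b := by
        refine ContinuousOn.intervalIntegrable_of_Icc hab.le fun x hx ↦ ?_
        exact ((hcont_inv _ (hne_edge _ (hne x hx))).comp (f := fun x : ℝ ↦ (x : ℂ) + y₀ * I)
          (hlin_h y₀).continuousAt).continuousWithinAt
      have h2 : IntervalIntegrable (fun x : ℝ ↦ deriv f₁ (x + y₀ * I) / f₁ (x + y₀ * I)) volume a b := by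
        refine ContinuousOn.intervalIntegrable_of_Icc hab.le fun x hx ↦ ?_
        exact ((hcont_f₁ _ (hmem x hx) (hne x hx)).comp (f := fun x : ℝ ↦ (x : ℂ) + y₀ * I)
          (hlin_h y₀).continuousAt).continuousWithinAt
      rw [← add_im, ← intervalIntegral.integral_add h1 h2]
      congr 1
      refine intervalIntegral.integral_congr fun x hx ↦ ?_
      rw [uIcc_of_le hab.le] at hx
      exact hsplit _ (hmem x hx) (hne_edge _ (hne x hx)) (hne x hx)
    -- right edge
    have e_right : (∫ y in c..d, (deriv f (b + y * I) / f (b + y * I)).re) =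
        (∫ y in c..d, ((m : ℂ) * ((b : ℂ) + y * I - ρ)⁻¹).re) +
          ∫ y in c..d, (deriv f₁ (b + y * I) / f₁ (b + y * I)).re := by
      have h1 : IntervalIntegrable (fun y : ℝ ↦ ((m : ℂ) * ((b : ℂ) + y * I - ρ)⁻¹).re) volume c d := by
        refine ContinuousOn.intervalIntegrable_of_Icc hcd.le fun y hy ↦ ?_
        exact (continuous_re.continuousAt.comp ((hcont_inv _ (hne_edge _ (h_right y hy))).comp
          (f := fun y : ℝ ↦ (b : ℂ) + y * I) (hlin_v b).continuousAt)).continuousWithinAt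
      have h2 : IntervalIntegrable (fun y : ℝ ↦ (deriv f₁ (b + y * I) / f₁ (b + y * I)).re)
          volume c d := by
        refine ContinuousOn.intervalIntegrable_of_Icc hcd.le fun y hy ↦ ?_
        exact (continuous_re.continuousAt.comp ((hcont_f₁ _ (hright_mem y hy) (h_right y hy)).comp
          (f := fun y : ℝ ↦ (b : ℂ) + y * I) (hlin_v b).continuousAt)).continuousWithinAt
      rw [← intervalIntegral.integral_add h1 h2]
      refine intervalIntegral.integral_congr fun y hy ↦ ?_
      rw [uIcc_of_le hcd.le] at hy
      rw [hsplit _ (hright_mem y hy) (hne_edge _ (h_right y hy)) (h_right y hy), add_re]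
    -- the `m/(z-ρ)` pieces
    have e_m_hor : ∀ y₀ : ℝ, (∫ x in a..b, (m : ℂ) * ((x : ℂ) + y₀ * I - ρ)⁻¹).im =
        m * (∫ x in a..b, ((x : ℂ) + y₀ * I - ρ)⁻¹).im := by
      intro y₀
      rw [intervalIntegral.integral_const_mul,
        show ((m : ℂ)) = ((m : ℝ) : ℂ) from (Complex.ofReal_natCast m).symm, im_ofReal_mul]
    have e_m_right : (∫ y in c..d, ((m : ℂ) * ((b : ℂ) + y * I - ρ)⁻¹).re) =
        m * (∫ y in c..d, ((b : ℂ) + y * I - ρ)⁻¹).re := by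
      have hint' : IntervalIntegrable (fun y : ℝ ↦ ((b : ℂ) + y * I - ρ)⁻¹) volume c d := by
        refine ContinuousOn.intervalIntegrable_of_Icc hcd.le fun y hy ↦ ?_
        have hz : ((b : ℂ) + y * I) ≠ ρ := hne_edge _ (h_right y hy)
        exact (((continuousAt_id.sub continuousAt_const).inv₀ (sub_ne_zero.2 hz)).comp
          (f := fun y : ℝ ↦ (b : ℂ) + y * I) (hlin_v b).continuousAt).continuousWithinAt
      have hcomm := Complex.reCLM.intervalIntegral_comp_comm (hint'.const_mul (m : ℂ))
      simp only [Complex.reCLM_apply] at hcomm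
      rw [hcomm, intervalIntegral.integral_const_mul,
        show ((m : ℂ)) = ((m : ℝ) : ℂ) from (Complex.ofReal_natCast m).symm, re_ofReal_mul]
    have e_three := threeEdge_inv_sub_eq_pi hab ht₀.1 ht₀.2
    -- assemble
    rw [e_left, e_sum, e_int, e_hor c (Or.inl rfl) h_bot, e_hor d (Or.inr rfl) h_top, e_right,
      e_m_hor, e_m_hor, e_m_right]
    have key : (m : ℝ) * (∫ x in a..b, ((x : ℂ) + c * I - ρ)⁻¹).im -
        (m : ℝ) * (∫ x in a..b, ((x : ℂ) + d * I - ρ)⁻¹).im +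
        (m : ℝ) * (∫ y in c..d, ((b : ℂ) + y * I - ρ)⁻¹).re = m * Real.pi := by
      rw [← e_three, hρ_def]
      ring
    linarith [hid₁, key]

/-- **The argument principle with zeros on the left edge.** Let `f` be analytic at every point of
the closed rectangle `K = [a,b] × [c,d]` (`a < b`, `c < d`) and non-zero on its bottom, top and
right edges (zeros on the left edge `{a} × (c,d)` are allowed). Then
`∫_c^d Re(f'/f)(a+it) dt + π Σ_{t ∈ (c,d), f(a+it)=0} m(a+it)`
`  = Im ∫_a^b (f'/f)(x+ic) dx − Im ∫_a^b (f'/f)(x+id) dx + ∫_c^d Re(f'/f)(b+it) dt − 2π Σ_{ρ ∈ K°, f(ρ)=0} m(ρ)`: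
the change of `arg f` up the left edge, continued by `+nπ` across each zero of multiplicity `n`,
equals the boundary terms of the other three edges minus `2π` times the number of zeros inside.
[cite: Conway1978, Ch. V Thm. 3.4] -/
theorem integral_re_logDeriv_left_add_finsum_eq {f : ℂ → ℂ} (hab : a < b) (hcd : c < d)
    (hf : AnalyticOnNhd ℂ f (Icc a b ×ℂ Icc c d))
    (h_bot : ∀ x ∈ Icc a b, f (x + c * I) ≠ 0) (h_top : ∀ x ∈ Icc a b, f (x + d * I) ≠ 0)
    (h_right : ∀ y ∈ Icc c d, f (b + y * I) ≠ 0) :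
    (∫ y in c..d, (deriv f (a + y * I) / f (a + y * I)).re) +
        Real.pi * ∑ᶠ t ∈ {t : ℝ | f (a + t * I) = 0 ∧ t ∈ Ioo c d},
          ((meromorphicOrderAt f (a + t * I)).untop₀ : ℝ) =
      (∫ x in a..b, deriv f (x + c * I) / f (x + c * I)).im -
        (∫ x in a..b, deriv f (x + d * I) / f (x + d * I)).im +
        (∫ y in c..d, (deriv f (b + y * I) / f (b + y * I)).re) -
        2 * Real.pi * ∑ᶠ ρ ∈ {ρ : ℂ | f ρ = 0 ∧ ρ ∈ Ioo a b ×ℂ Ioo c d},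
          ((meromorphicOrderAt f ρ).untop₀ : ℝ) := by
  have hcorner : ((a : ℂ) + c * I) ∈ Icc a b ×ℂ Icc c d :=
    ⟨by simpa using hab.le, by simpa using hcd.le⟩
  have hw : f (a + c * I) ≠ 0 := h_bot a ⟨le_rfl, hab.le⟩
  have hfin : {t : ℝ | f (a + t * I) = 0 ∧ t ∈ Ioo c d}.Finite :=
    (finite_leftEdge_zeros hab.le hcd.le hf hcorner hw).subset fun t ht ↦
      ⟨ht.1, Ioo_subset_Icc_self ht.2⟩
  -- zeros on the closed left edge have ordinates in `(c, d)` (the corners are on the other edges)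
  have hzero : ∀ y ∈ Icc c d, f (a + y * I) = 0 → y ∈ hfin.toFinset := by
    intro y hy h0
    rw [Set.Finite.mem_toFinset]
    refine ⟨h0, ?_⟩
    rcases hy.1.eq_or_lt with h | hcy
    · exact absurd h0 (by rw [← h]; exact h_bot a ⟨le_rfl, hab.le⟩)
    rcases hy.2.eq_or_lt with h | hyd
    · exact absurd h0 (by rw [h]; exact h_top a ⟨le_rfl, hab.le⟩)
    exact ⟨hcy, hyd⟩
  have hsub : ((hfin.toFinset : Set ℝ)) ⊆ Ioo c d := fun t ht ↦ by
    rw [Set.Finite.coe_toFinset] at ht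
    exact ht.2
  have h := (integral_re_logDeriv_left_add_sum_eq hab hcd hfin.toFinset f hf h_bot h_top h_right
    hzero hsub).2
  rwa [← finsum_mem_eq_finite_toFinset_sum _ hfin] at h

/-- Under the same hypotheses, `t ↦ Re (f'/f)(a+it)` is integrable on `[c, d]` (it is bounded and
continuous off the finitely many ordinates of zeros). [folklore] -/
theorem intervalIntegrable_re_logDeriv_left {f : ℂ → ℂ} (hab : a < b) (hcd : c < d)
    (hf : AnalyticOnNhd ℂ f (Icc a b ×ℂ Icc c d))
    (h_bot : ∀ x ∈ Icc a b, f (x + c * I) ≠ 0) (h_top : ∀ x ∈ Icc a b, f (x + d * I) ≠ 0)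
    (h_right : ∀ y ∈ Icc c d, f (b + y * I) ≠ 0) :
    IntervalIntegrable (fun y : ℝ ↦ (deriv f (a + y * I) / f (a + y * I)).re) volume c d := by
  have hcorner : ((a : ℂ) + c * I) ∈ Icc a b ×ℂ Icc c d :=
    ⟨by simpa using hab.le, by simpa using hcd.le⟩
  have hw : f (a + c * I) ≠ 0 := h_bot a ⟨le_rfl, hab.le⟩
  have hfin : {t : ℝ | f (a + t * I) = 0 ∧ t ∈ Ioo c d}.Finite :=
    (finite_leftEdge_zeros hab.le hcd.le hf hcorner hw).subset fun t ht ↦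
      ⟨ht.1, Ioo_subset_Icc_self ht.2⟩
  have hzero : ∀ y ∈ Icc c d, f (a + y * I) = 0 → y ∈ hfin.toFinset := by
    intro y hy h0
    rw [Set.Finite.mem_toFinset]
    refine ⟨h0, ?_⟩
    rcases hy.1.eq_or_lt with h | hcy
    · exact absurd h0 (by rw [← h]; exact h_bot a ⟨le_rfl, hab.le⟩)
    rcases hy.2.eq_or_lt with h | hyd
    · exact absurd h0 (by rw [h]; exact h_top a ⟨le_rfl, hab.le⟩)
    exact ⟨hcy, hyd⟩
  have hsub : ((hfin.toFinset : Set ℝ)) ⊆ Ioo c d := fun t ht ↦ by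
    rw [Set.Finite.coe_toFinset] at ht
    exact ht.2
  exact (integral_re_logDeriv_left_add_sum_eq hab hcd hfin.toFinset f hf h_bot h_top h_right
    hzero hsub).1

end Literature.Analysis.Complex

end
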